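import Mathlib
import Summits.Langlands.Langlands.Theorems.PhantomRMYoshidaStableYoshidaCongruenceSector
import Summits.Langlands.Langlands.Theorems.PhantomRMYoshidaStableYoshidaCongruenceOrdinaryFrameFpDescent
import Literature.RepresentationTheory.Semisimple.BrauerNesbitt
import Literature.NumberTheory.GaloisRepresentations.ModPGaloisRepCyclotomicProofs
import Literature.NumberTheory.GaloisRepresentations.LocalKroneckerWeberInertiaProofs
import HarnessLib

/-!
# Route `PhantomRMYoshida`, crux `StableYoshidaCongruence` (stmt-Langlands-13640), line
# `burkhardt-weddle-two-three-anchor`: Stub 5 `stub_ordinaryFrameFp` — the ordinary `𝔽_p`-frame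

`p` odd, `k` of characteristic `p`, `σ, σ' : Γ_ℚ → GL₂(k)` irreducible with
`det σ = det σ' = ε̄⁻¹` (LTWS `DetCond`), `v ∣ p`, `ρb : Γ_ℚ → GL₄(𝔽_p)` an `𝔽_p`-model of
`σ ⊕ σ'` (LTWS `IsModelOf`), and `M : Γ_ℚ → GL₄(k)` with the characteristic polynomials of
`σ ⊕ σ'` (M1), block upper triangular at `v` (M2) with inertia trivial on the top `2 × 2` block
(M3) — the reduction of the Greenberg-adapted lattice of the H5-witness, produced by the lead's
`stub_residualLattice`.  Then `ρb|Γ_{ℚ_v}` has an ORDINARY `𝔽_p`-FRAME: verbatim the three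
frame clauses of LTWS `IsOrdinaryFlatAt p v ρb` (registered signature `stub_ordinaryFrameFp`).

Proof.
* ORIENTATION (`finrank_invariants_inertia_eq_one`, the content H5 certifies): the inertia
  invariants of `σ|Γ_v` and `σ'|Γ_v` are LINES.  The top plane of `k⁴` is inertia invariant for
  `M` (M2–M3), so `dim (k⁴, M)^I ≥ 2`; a semisimplification `M'` of `M` has `dim M'^I ≥ dim M^I`
  (invariants are left exact, `exists_semisimplification_invariants`) and `M' ≅ σ ⊕ σ'` by
  Brauer–Nesbitt (tree `Representation.nonempty_equiv_of_charpoly_eq`: both are semisimple with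
  the characteristic polynomials of (M1)), so `dim σ^I + dim σ'^I ≥ 2`, while each is `≤ 1`
  because `det = ε̄⁻¹` takes the value `(-1)⁻¹ ≠ 1` at an inertia element `τ₀`
  (`χ_p(I_{ℚ_v}) = ℤ_pˣ`, tree `adicCompletion_rat_exists_mem_absInertia_cyclotomicCharacter_eq`,
  and `ε̄ = χ_p mod p`, tree `toZMod_cyclotomicCharacter_apply`).
* BLOCKS (`block_hyps`): for each of `σ|Γ_v`, `σ'|Γ_v` the line `ℓ` of inertia invariants is
  exactly `ker(σ(τ₀) - 1)`, is `Γ_v`-stable (`I_v ⊴ Γ_v`), inertia-fixed, and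
  `σ(τ) ≡ ε̄(τ)⁻¹ mod ℓ` on inertia (`det σ(τ) = ε̄(τ)⁻¹` and the `2 × 2` identity
  `(σ(τ₀) - 1)(σ(τ) - det σ(τ)) = 0`).
* DESCENT (`frame_descent`, file `…OrdinaryFrameFpDescent.lean`): `U := ker(ρb(τ₀) - 1) ⊆ 𝔽_p⁴`
  is a plane (nullity is invariant under `𝔽_p → k` and conjugation), `Γ_v`-stable,
  inertia-fixed, with scalar `ε̄⁻¹` on `𝔽_p⁴/U`; a basis of `𝔽_p⁴` extending one of `U` is
  the frame.

Everything used is proved in the tree; no named fact is taken as a hypothesis.  Worker of lead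
prover-line-stmt-Langlands-13640-c1-0 (2026-08-16).
-/

-- `Summit.Langlands.Langlands.…` (summit = sub-problem name, D-0017 layout) trips `dupNamespace`.
set_option linter.dupNamespace false

noncomputable section

open Module IsDedekindDomain Matrix
open scoped NumberField
open Literature.NumberTheory.GaloisRepresentations
open Literature.RepresentationTheory.Semisimple
open Summit.Langlands.Langlands.Cruxes.StableYoshidaCongruence.LevelThreeWeierstrassSwitch

namespace Summit.Langlands.Langlands.Cruxes.StableYoshidaCongruence.BurkhardtWeddleTwoThreeAnchor

/-! ## The block hypotheses from a one-dimensional space of inertia invariants -/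

section Block

variable {E : Type*} [Field E] {Γ : Type*} [Group Γ]

/-- **The four block hypotheses of `frame_descent`.**  Let `S : Γ → GL₂(E)`, `I ⊴ Γ` normal,
and suppose the subspace `L ⊆ E²` of vectors fixed by `S(I)` is a LINE, `det S τ = d τ` on `I`
and `d τ₀ ≠ 1` for some `τ₀ ∈ I`.  Then `N := S τ₀ - 1` has kernel exactly `L` (it contains `L`
and is not everything since `det S τ₀ ≠ 1`), which is stable under every `S γ` (normality of
`I`), fixed by `S τ`, `τ ∈ I`, and `N (S τ - d τ) = 0` for `τ ∈ I`
(`mul_sub_det_smul_one_eq_zero`). [folklore] -/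
theorem block_hyps (I : Subgroup Γ) [hIn : I.Normal] (S : Γ →* GL (Fin 2) E) (d : Γ → E)
    (hd : ∀ τ ∈ I, ((S τ : GL (Fin 2) E) : Matrix (Fin 2) (Fin 2) E).det = d τ)
    {τ₀ : Γ} (hτ₀ : τ₀ ∈ I) (hd₀ : d τ₀ ≠ 1) (L : Submodule E (Fin 2 → E))
    (hL : ∀ w, w ∈ L ↔
      ∀ τ ∈ I, ((S τ : GL (Fin 2) E) : Matrix (Fin 2) (Fin 2) E) *ᵥ w = w)
    (hL1 : finrank E L = 1) :
    finrank E (LinearMap.ker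
      (((S τ₀ : GL (Fin 2) E) : Matrix (Fin 2) (Fin 2) E) - 1).mulVecLin) = 1 ∧
    (∀ γ, LinearMap.ker (((S τ₀ : GL (Fin 2) E) : Matrix (Fin 2) (Fin 2) E) - 1).mulVecLin ≤
      LinearMap.ker ((((S τ₀ : GL (Fin 2) E) : Matrix (Fin 2) (Fin 2) E) - 1) *
        ((S γ : GL (Fin 2) E) : Matrix (Fin 2) (Fin 2) E)).mulVecLin) ∧
    (∀ τ ∈ I,
      LinearMap.ker (((S τ₀ : GL (Fin 2) E) : Matrix (Fin 2) (Fin 2) E) - 1).mulVecLin ≤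
      LinearMap.ker (((S τ : GL (Fin 2) E) : Matrix (Fin 2) (Fin 2) E) - 1).mulVecLin) ∧
    (∀ τ ∈ I, (((S τ₀ : GL (Fin 2) E) : Matrix (Fin 2) (Fin 2) E) - 1) *
      (((S τ : GL (Fin 2) E) : Matrix (Fin 2) (Fin 2) E) - d τ • 1) = 0) := by
  set N : Matrix (Fin 2) (Fin 2) E := ((S τ₀ : GL (Fin 2) E) : Matrix (Fin 2) (Fin 2) E) - 1
    with hN
  have hmemker : ∀ (X : Matrix (Fin 2) (Fin 2) E) (w : Fin 2 → E),
      w ∈ LinearMap.ker (X - 1).mulVecLin ↔ X *ᵥ w = w := fun X w => by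
    rw [LinearMap.mem_ker, Matrix.mulVecLin_apply, Matrix.sub_mulVec, Matrix.one_mulVec,
      sub_eq_zero]
  -- `L ≤ ker N`, `ker N ≠ ⊤`, hence `ker N = L` is a line
  have hLker : L ≤ LinearMap.ker N.mulVecLin := fun w hw =>
    (hmemker _ w).2 ((hL w).1 hw τ₀ hτ₀)
  have hker_ne_top : LinearMap.ker N.mulVecLin ≠ ⊤ := by
    intro htop
    have h1 : ((S τ₀ : GL (Fin 2) E) : Matrix (Fin 2) (Fin 2) E) = 1 := by
      refine Matrix.toLin'.injective (LinearMap.ext fun w => ?_)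
      rw [Matrix.toLin'_apply, Matrix.toLin'_one, LinearMap.id_apply]
      exact (hmemker _ w).1 (htop ▸ Submodule.mem_top)
    have h2 := hd τ₀ hτ₀
    rw [h1, Matrix.det_one] at h2
    exact hd₀ h2.symm
  have hle1 : finrank E (LinearMap.ker N.mulVecLin) ≤ 1 := by
    have h := Submodule.finrank_lt hker_ne_top
    rw [Module.finrank_fin_fun] at h
    omega
  have hge1 : 1 ≤ finrank E (LinearMap.ker N.mulVecLin) :=
    calc 1 = finrank E L := hL1.symm
      _ ≤ _ := Submodule.finrank_mono hLker
  have hS1 : finrank E (LinearMap.ker N.mulVecLin) = 1 := le_antisymm hle1 hge1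
  have hLeq : L = LinearMap.ker N.mulVecLin :=
    Submodule.eq_of_le_of_finrank_eq hLker (hL1.trans hS1.symm)
  refine ⟨hS1, fun γ w hw => ?_, fun τ hτ w hw => ?_, fun τ hτ => ?_⟩
  · -- stability of `L` under `S γ`, by normality of `I`
    rw [← hLeq, hL] at hw
    rw [LinearMap.mem_ker, Matrix.mulVecLin_apply, ← Matrix.mulVec_mulVec]
    have hmem : ((S γ : GL (Fin 2) E) : Matrix (Fin 2) (Fin 2) E) *ᵥ w ∈ L := by
      refine (hL _).2 fun τ hτ => ?_
      have hconj : γ⁻¹ * τ * γ ∈ I := by simpa using hIn.conj_mem τ hτ γ⁻¹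
      have hτγ : τ * γ = γ * (γ⁻¹ * τ * γ) := by group
      rw [Matrix.mulVec_mulVec, ← Units.val_mul, ← map_mul, hτγ, map_mul, Units.val_mul,
        ← Matrix.mulVec_mulVec, hw _ hconj]
    rw [hLeq] at hmem
    exact hmem
  · rw [← hLeq, hL] at hw
    exact (hmemker _ w).2 (hw τ hτ)
  · -- `N (S τ - d τ) = 0`
    have hLbot : L ≠ ⊥ := fun h => by rw [h, finrank_bot] at hL1; exact zero_ne_one hL1
    obtain ⟨w, hwL, hw0⟩ := Submodule.exists_mem_ne_zero_of_ne_bot hLbot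
    have hNw : N *ᵥ w = 0 := by
      have := hLker hwL
      rwa [LinearMap.mem_ker, Matrix.mulVecLin_apply] at this
    rw [← hd τ hτ]
    exact mul_sub_det_smul_one_eq_zero hw0 hNw ((hL w).1 hwL τ hτ)

end Block

/-! ## Orientation: the inertia invariants of `σ|Γ_v`, `σ'|Γ_v` are lines -/

section Orientation

variable {p : ℕ} [Fact p.Prime] {k : Type} [Field k] [CharP k p] [TopologicalSpace k]
  [DiscreteTopology k]

/-- An inertia element `τ₀ ∈ I_{ℚ_v}` (`v ∣ p`, `p` odd) on which the mod-`p` cyclotomic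
character `ε̄` (pushed to `Γ_ℚ`) is `-1 ≠ 1`: `χ_p(I_{ℚ_v}) = ℤ_pˣ ∋ -1` and `ε̄ = χ_p mod p`.
[folklore] -/
theorem exists_mem_absInertia_epsBar_ne_one (hp : p ≠ 2) (v : HeightOneSpectrum (𝓞 ℚ))
    (hv : ((p : ℕ) : 𝓞 ℚ) ∈ v.asIdeal) :
    ∃ τ₀ ∈ absInertia (v.adicCompletion ℚ),
      epsBar p (absGaloisRestrict ℚ (v.adicCompletion ℚ) τ₀) ≠ 1 := by
  obtain ⟨τ₀, hτ₀I, hτ₀⟩ :=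
    adicCompletion_rat_exists_mem_absInertia_cyclotomicCharacter_eq p v
      (primesEquiv_eq_of_natCast_mem p v hv) (-1)
  refine ⟨τ₀, hτ₀I, fun h1 => ?_⟩
  have h := toZMod_cyclotomicCharacter_apply ℚ p (absGaloisRestrict ℚ (v.adicCompletion ℚ) τ₀)
  rw [cyclotomicCharacter_absGaloisRestrict, hτ₀, Units.val_neg, Units.val_one, map_neg, map_one]
    at h
  have h2 : (modPCyclotomicCharacterZMod ℚ p
      (absGaloisRestrict ℚ (v.adicCompletion ℚ) τ₀) : ZMod p) = 1 := by
    change (epsBar p (absGaloisRestrict ℚ (v.adicCompletion ℚ) τ₀) : ZMod p) = 1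
    rw [h1, Units.val_one]
  rw [h2] at h
  exact Ring.neg_one_ne_one_of_char_ne_two (by rw [ZMod.ringChar_zmod_n p]; exact hp) h

/-- `det σ = ε̄⁻¹` read on matrices: `det σ(g) = ι(ε̄(g)⁻¹)`, `ι : 𝔽_p → k`.
[folklore] -/
theorem det_val_eq_of_det_eq {σ : FramedGaloisRep ℚ k 2} {g : Field.absoluteGaloisGroup ℚ}
    (h : FramedRep.det σ g =
      (Units.map (ZMod.castHom (dvd_refl p) k).toMonoidHom (epsBar p g))⁻¹) :
    ((σ g : GL (Fin 2) k) : Matrix (Fin 2) (Fin 2) k).det =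
      ZMod.castHom (dvd_refl p) k (((epsBar p g)⁻¹ : (ZMod p)ˣ) : ZMod p) := by
  have h1 := congrArg Units.val h
  rw [FramedRep.det_apply, Matrix.GeneralLinearGroup.val_det_apply, Units.coe_map_inv] at h1
  exact h1

/-- **The orientation lemma.**  With the hypotheses of the stub: for the representations of the
inertia group `I_{ℚ_v}` (through `Γ_{ℚ_v} → Γ_ℚ`) on `k²` by `σ` and by `σ'`, the spaces of
invariants are LINES.  Proof: `dim (k⁴, M)^I ≥ 2` (the top plane, by (M2)–(M3)); semisimplifying
`M` does not shrink invariants (`exists_semisimplification_invariants`) and `M^{ss} ≅ σ ⊕ σ'` by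
Brauer–Nesbitt (same characteristic polynomials (M1), `σ ⊕ σ'` semisimple), so
`dim σ^I + dim σ'^I ≥ 2`; and each is `≤ 1` since `det σ = det σ' = ε̄⁻¹` is non-trivial on `I`
(`p` odd). [cite: BourbakiAlgebreVIII2012, VIII § 20 n° 6, Thm. 2, Cor. 1 (p. 378)] -/
theorem finrank_invariants_inertia_eq_one (hp : p ≠ 2) (σ σ' : FramedGaloisRep ℚ k 2)
    (M : FramedGaloisRep ℚ k 4) (v : HeightOneSpectrum (𝓞 ℚ))
    (hv : ((p : ℕ) : 𝓞 ℚ) ∈ v.asIdeal) (hirr : σ.toGaloisRep.IsIrreducible)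
    (hirr' : σ'.toGaloisRep.IsIrreducible) (hdet : DetCond p σ σ')
    (hM1 : ∀ τ : Field.absoluteGaloisGroup ℚ,
      FramedRep.charpoly M τ = FramedRep.charpoly σ τ * FramedRep.charpoly σ' τ)
    (hM2 : ∀ τ : Field.absoluteGaloisGroup (v.adicCompletion ℚ),
      (M.toLocal v τ).val 1 0 = 0 ∧ (M.toLocal v τ).val 2 0 = 0 ∧ (M.toLocal v τ).val 3 0 = 0 ∧
      (M.toLocal v τ).val 2 1 = 0 ∧ (M.toLocal v τ).val 3 1 = 0)
    (hM3 : ∀ τ ∈ absInertia (v.adicCompletion ℚ),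
      (M.toLocal v τ).val 0 0 = 1 ∧ (M.toLocal v τ).val 1 1 = 1 ∧ (M.toLocal v τ).val 0 1 = 0) :
    finrank k (Representation.invariants (σ.toRepresentation.comp
      ((absGaloisRestrict ℚ (v.adicCompletion ℚ)).toMonoidHom.comp
        (absInertia (v.adicCompletion ℚ)).subtype))) = 1 ∧
    finrank k (Representation.invariants (σ'.toRepresentation.comp
      ((absGaloisRestrict ℚ (v.adicCompletion ℚ)).toMonoidHom.comp
        (absInertia (v.adicCompletion ℚ)).subtype))) = 1 := by
  set φ : absInertia (v.adicCompletion ℚ) →* Field.absoluteGaloisGroup ℚ :=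
    (absGaloisRestrict ℚ (v.adicCompletion ℚ)).toMonoidHom.comp
      (absInertia (v.adicCompletion ℚ)).subtype with hφ
  have hφapply : ∀ h, φ h = absGaloisRestrict ℚ (v.adicCompletion ℚ)
      (h : Field.absoluteGaloisGroup (v.adicCompletion ℚ)) := fun _ => rfl
  -- the three representations of `Γ_ℚ`
  set RM : Representation k (Field.absoluteGaloisGroup ℚ) (Fin 4 → k) := M.toRepresentation
    with hRM
  haveI : σ.toRepresentation.IsIrreducible := hirr
  haveI : σ'.toRepresentation.IsIrreducible := hirr'
  set D : Representation k (Field.absoluteGaloisGroup ℚ) ((Fin 2 → k) × (Fin 2 → k)) :=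
    σ.toRepresentation.prod σ'.toRepresentation with hD
  have hcpM : ∀ g, (RM g).charpoly = FramedRep.charpoly M g := fun g => by
    have : RM g = Matrix.toLin' ((M g : GL (Fin 4) k) : Matrix (Fin 4) (Fin 4) k) :=
      LinearMap.ext fun w => rfl
    rw [this, Matrix.charpoly_toLin']
    rfl
  have hcp2 : ∀ (s : FramedGaloisRep ℚ k 2) g,
      (s.toRepresentation g).charpoly = FramedRep.charpoly s g := fun s g => by
    have : s.toRepresentation g = Matrix.toLin' ((s g : GL (Fin 2) k) : Matrix (Fin 2) (Fin 2) k) :=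
      LinearMap.ext fun w => rfl
    rw [this, Matrix.charpoly_toLin']
    rfl
  have hcpD : ∀ g, (D g).charpoly = FramedRep.charpoly σ g * FramedRep.charpoly σ' g :=
      fun g => by
    change ((σ.toRepresentation g).prodMap (σ'.toRepresentation g)).charpoly = _
    rw [LinearMap.charpoly_prodMap, hcp2, hcp2]
  -- semisimplification of `M` and Brauer–Nesbitt
  obtain ⟨V', _, _, _, ρ', hss, hcp', hinv'⟩ :=
    exists_semisimplification_invariants φ (Fin 4 → k) RM
  haveI := hss
  obtain ⟨e⟩ := Representation.nonempty_equiv_of_charpoly_eq ρ' D fun g => by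
    rw [hcp' g, hcpM, hcpD, hM1]
  have hinvD : finrank k (Representation.invariants (ρ'.comp φ)) =
      finrank k (Representation.invariants (σ.toRepresentation.comp φ)) +
        finrank k (Representation.invariants (σ'.toRepresentation.comp φ)) := by
    rw [← finrank_invariants_prod]
    exact finrank_invariants_eq_of_equiv
      (Representation.Equiv.mk (ρ := ρ'.comp φ)
        (σ := Representation.prod (σ.toRepresentation.comp φ) (σ'.toRepresentation.comp φ))
        e.toLinearEquiv fun h => e.isIntertwining' (φ h))
  -- lower bound: the top plane is inertia invariant
  have hbasis : ∀ (j : Fin 4), (j : ℕ) < 2 →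
      (Pi.basisFun k (Fin 4)) j ∈ Representation.invariants (RM.comp φ) := by
    intro j hj
    refine (Representation.mem_invariants _ _).2 fun h => ?_
    obtain ⟨h10, h20, h30, h21, h31⟩ :=
      hM2 (h : Field.absoluteGaloisGroup (v.adicCompletion ℚ))
    obtain ⟨h00, h11, h01⟩ := hM3 (h : Field.absoluteGaloisGroup (v.adicCompletion ℚ)) h.2
    rw [FramedGaloisRep.toLocal_apply] at h10 h20 h30 h21 h31 h00 h11 h01
    change ((M (φ h) : GL (Fin 4) k) : Matrix (Fin 4) (Fin 4) k) *ᵥ (Pi.basisFun k (Fin 4)) j =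
      (Pi.basisFun k (Fin 4)) j
    rw [hφapply, Pi.basisFun_apply, Matrix.mulVec_single_one]
    funext i
    rw [Matrix.col_apply]
    have hj2 : j = 0 ∨ j = 1 := by revert hj; fin_cases j <;> decide
    rcases hj2 with rfl | rfl <;> fin_cases i <;> simp [h10, h20, h30, h21, h31, h00, h11, h01]
  have hLI : LinearIndependent k fun i : Fin 2 =>
      (Pi.basisFun k (Fin 4)) (Fin.castLE (by norm_num) i) :=
    (Pi.basisFun k (Fin 4)).linearIndependent.comp _ (Fin.castLE_injective _)
  have h2le : 2 ≤ finrank k (Representation.invariants (RM.comp φ)) := by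
    have hspan : Submodule.span k (Set.range fun i : Fin 2 =>
        (Pi.basisFun k (Fin 4)) (Fin.castLE (by norm_num) i)) ≤
          Representation.invariants (RM.comp φ) := by
      rw [Submodule.span_le]
      rintro _ ⟨i, rfl⟩
      exact hbasis _ i.2
    calc 2 = finrank k (Submodule.span k (Set.range fun i : Fin 2 =>
          (Pi.basisFun k (Fin 4)) (Fin.castLE (by norm_num) i))) := by
            rw [finrank_span_eq_card hLI, Fintype.card_fin]
      _ ≤ _ := Submodule.finrank_mono hspan
  -- upper bounds: `det = ε̄⁻¹` is ramified
  obtain ⟨τ₀, hτ₀I, hτ₀⟩ := exists_mem_absInertia_epsBar_ne_one hp v hv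
  have hub : ∀ s : FramedGaloisRep ℚ k 2,
      (∀ g, FramedRep.det s g =
        (Units.map (ZMod.castHom (dvd_refl p) k).toMonoidHom (epsBar p g))⁻¹) →
      finrank k (Representation.invariants (s.toRepresentation.comp φ)) ≤ 1 := by
    intro s hs
    by_contra hlt
    have htop : Representation.invariants (s.toRepresentation.comp φ) = ⊤ := by
      apply Submodule.eq_top_of_finrank_eq
      refine le_antisymm (Submodule.finrank_le _) ?_
      rw [Module.finrank_fin_fun]
      omega
    have h1 : ((s (φ ⟨τ₀, hτ₀I⟩) : GL (Fin 2) k) : Matrix (Fin 2) (Fin 2) k) = 1 := by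
      refine Matrix.toLin'.injective (LinearMap.ext fun w => ?_)
      rw [Matrix.toLin'_apply, Matrix.toLin'_one, LinearMap.id_apply]
      have hw : w ∈ Representation.invariants (s.toRepresentation.comp φ) :=
        htop ▸ Submodule.mem_top
      exact (Representation.mem_invariants _ _).1 hw ⟨τ₀, hτ₀I⟩
    have h2 := det_val_eq_of_det_eq (hs (φ ⟨τ₀, hτ₀I⟩))
    rw [h1, Matrix.det_one, eq_comm, map_eq_one_iff _ (ZMod.castHom_injective k), Units.val_eq_one,
      inv_eq_one] at h2
    exact hτ₀ h2
  have hσ := hub σ fun g => (hdet g).1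
  have hσ' := hub σ' fun g => (hdet g).2.trans (hdet g).1
  omega

end Orientation

/-! ## The stub -/

/-- **Stub 5 (`stub_ordinaryFrameFp`).**  `p` odd; `σ, σ'` irreducible with
`det σ = det σ' = ε̄⁻¹` (`DetCond`); `v ∣ p`; `ρb` an `𝔽_p`-model of `σ ⊕ σ'` (`IsModelOf`);
`M : Γ_ℚ → GL₄(k)` with (M1)–(M3) of `stub_residualLattice`.  Then `ρb|Γ_{ℚ_v}` has an ordinary
`𝔽_p`-frame (the three frame clauses of LTWS `IsOrdinaryFlatAt p v ρb`).  Proof: ORIENTATION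
(`finrank_invariants_inertia_eq_one`: the inertia invariants `ℓ ⊂ σ|Γ_v`, `ℓ' ⊂ σ'|Γ_v` are
lines — the content H5 certifies) gives, for an inertia element `τ₀` with `ε̄(τ₀) ≠ 1`, the block
hypotheses (`block_hyps`: `ker(σ(τ₀) - 1) = ℓ` is `Γ_v`-stable, inertia-fixed, and
`σ(τ) ≡ ε̄(τ)⁻¹ mod ℓ` on inertia since `det σ = ε̄⁻¹`), and DESCENT (`frame_descent`:
`U := ker(ρb(τ₀) - 1) ⊆ 𝔽_p⁴` is a `Γ_v`-stable plane with inertia trivial on it and scalar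
`ε̄⁻¹` on the quotient; kernels commute with `𝔽_p → k` and with the conjugation of `IsModelOf`)
produces the frame.
[cite: BoxerCalegariGeePilloni2025, Cor. 9.3.5 and Lemma 9.4.2 (arXiv:2502.20645)]
[cite: BourbakiAlgebreVIII2012, VIII § 20 n° 6, Thm. 2, Cor. 1 (p. 378)] -/
theorem stub_ordinaryFrameFp :
    ∀ (p : ℕ) [Fact p.Prime], p ≠ 2 → ∀ (k : Type) [Field k] [CharP k p] [IsAlgClosed k]
      [TopologicalSpace k] [DiscreteTopology k] (σ σ' : FramedGaloisRep ℚ k 2)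
      (ρb : FramedGaloisRep ℚ (ZMod p) 4) (M : FramedGaloisRep ℚ k 4)
      (v : HeightOneSpectrum (𝓞 ℚ)), ((p : ℕ) : 𝓞 ℚ) ∈ v.asIdeal →
      σ.toGaloisRep.IsIrreducible → σ'.toGaloisRep.IsIrreducible → DetCond p σ σ' →
      IsModelOf ρb σ σ' →
      (∀ τ : Field.absoluteGaloisGroup ℚ,
        FramedRep.charpoly M τ = FramedRep.charpoly σ τ * FramedRep.charpoly σ' τ) →
      (∀ τ : Field.absoluteGaloisGroup (v.adicCompletion ℚ),
        (M.toLocal v τ).val 1 0 = 0 ∧ (M.toLocal v τ).val 2 0 = 0 ∧ (M.toLocal v τ).val 3 0 = 0 ∧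
        (M.toLocal v τ).val 2 1 = 0 ∧ (M.toLocal v τ).val 3 1 = 0) →
      (∀ τ ∈ absInertia (v.adicCompletion ℚ),
        (M.toLocal v τ).val 0 0 = 1 ∧ (M.toLocal v τ).val 1 1 = 1 ∧ (M.toLocal v τ).val 0 1 = 0) →
      ∃ g : GL (Fin 4) (ZMod p),
        (∀ (τ : Field.absoluteGaloisGroup (v.adicCompletion ℚ)) (i j : Fin 4), 2 ≤ (i : ℕ) → (j : ℕ) < 2 →
            (g * ρb.toLocal v τ * g⁻¹).val i j = 0) ∧
        (∀ τ ∈ absInertia (v.adicCompletion ℚ), ∀ i j : Fin 4, (i : ℕ) < 2 → (j : ℕ) < 2 →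
            (g * ρb.toLocal v τ * g⁻¹).val i j = if i = j then 1 else 0) ∧
        (∀ τ ∈ absInertia (v.adicCompletion ℚ), ∀ i j : Fin 4, 2 ≤ (i : ℕ) → 2 ≤ (j : ℕ) →
            (g * ρb.toLocal v τ * g⁻¹).val i j =
              if i = j then (((epsBar p (absGaloisRestrict ℚ (v.adicCompletion ℚ) τ))⁻¹ : (ZMod p)ˣ) : ZMod p)
              else 0) := by
  intro p _ hp k _ _ _ _ _ σ σ' ρb M v hv hirr hirr' hdet hmodel hM1 hM2 hM3
  haveI hIn : (absInertia (v.adicCompletion ℚ)).Normal := absInertia_normal_holds _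
  obtain ⟨h1, h1'⟩ :=
    finrank_invariants_inertia_eq_one hp σ σ' M v hv hirr hirr' hdet hM1 hM2 hM3
  obtain ⟨τ₀, hτ₀I, hτ₀⟩ := exists_mem_absInertia_epsBar_ne_one hp v hv
  obtain ⟨h, hh⟩ := hmodel
  -- the block hypotheses for `σ|Γ_v` and `σ'|Γ_v`
  set ι := ZMod.castHom (dvd_refl p) k with hι
  set d : Field.absoluteGaloisGroup (v.adicCompletion ℚ) → k := fun τ =>
    ι (((epsBar p (absGaloisRestrict ℚ (v.adicCompletion ℚ) τ))⁻¹ : (ZMod p)ˣ) : ZMod p)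
    with hd
  have hd₀ : d τ₀ ≠ 1 := fun h1 => hτ₀ (inv_eq_one.1 (Units.val_eq_one.1
    ((map_eq_one_iff ι (ZMod.castHom_injective k)).1 h1)))
  have hblock : ∀ s : FramedGaloisRep ℚ k 2,
      (∀ g, FramedRep.det s g =
        (Units.map (ZMod.castHom (dvd_refl p) k).toMonoidHom (epsBar p g))⁻¹) →
      finrank k (Representation.invariants (s.toRepresentation.comp
        ((absGaloisRestrict ℚ (v.adicCompletion ℚ)).toMonoidHom.comp
          (absInertia (v.adicCompletion ℚ)).subtype))) = 1 → _ :=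
    fun s hs hs1 => block_hyps (absInertia (v.adicCompletion ℚ)) (s.toLocal v).toMonoidHom d
      (fun τ _ => det_val_eq_of_det_eq (hs _)) hτ₀I hd₀ _
      (fun w => by
        rw [Representation.mem_invariants, Subtype.forall]
        rfl) hs1
  obtain ⟨b1, b2, b3, b4⟩ := hblock σ (fun g => (hdet g).1) h1
  obtain ⟨b1', b2', b3', b4'⟩ := hblock σ' (fun g => (hdet g).2.trans (hdet g).1) h1'
  -- descent
  exact frame_descent ι (absInertia (v.adicCompletion ℚ)) (ρb.toLocal v).toMonoidHom
    ![(σ.toLocal v).toMonoidHom, (σ'.toLocal v).toMonoidHom] h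
    (fun γ => hh (absGaloisRestrict ℚ (v.adicCompletion ℚ) γ))
    (fun τ => (((epsBar p (absGaloisRestrict ℚ (v.adicCompletion ℚ) τ))⁻¹ : (ZMod p)ˣ) : ZMod p))
    τ₀
    (fun i => by fin_cases i <;> [exact b1; exact b1'])
    (fun i => by fin_cases i <;> [exact b2; exact b2'])
    (fun i => by fin_cases i <;> [exact b3; exact b3'])
    (fun i => by fin_cases i <;> [exact b4; exact b4'])

end Summit.Langlands.Langlands.Cruxes.StableYoshidaCongruence.BurkhardtWeddleTwoThreeAnchor

end
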